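import Mathlib
import HarnessLib
import Summits.Ventures.LatticeQCDFlow.Exactness.SU2LuscherDeterminant
import Summits.Ventures.LatticeQCDFlow.Exactness.SU2KickPositiveJacobian

/-!
# The engine's truncated `Φ`-series on the `SU(2)` rung, in quaternion coordinates: every term, every partial sum, and the limit

HONEST FRAMING: exact (Metropolis-corrected) sampling algorithms for lattice gauge theory;
figures of merit are autocorrelation/cost numbers at stated couplings and volumes; no
continuum-physics claim.

Venture `LatticeQCDFlow` (cell pub-lqcd), topic `Exactness`; FANOUT row 14 (`eng-flowhmc`, engine
`latflow.fthmc`, family B; `flows_jax.layers._phi_apply(Q, DQ, terms=K)`: the booked matrix is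
`M_K[a,b] = coords_a(Σ_{k<K} (−1)^k ad_Q^k (DQ[T_b]) / (k+1)!) + δ_ab`, `K = phi_terms_needed(κ)`).
NEW WORK of the cell; no number.  Sequel of `SU2LuscherDeterminant.lean`, which proved that the
FULL series has determinant equal to the booked closed-form density.  Here the dictionary between
the engine's matrix operations and the `3 × 3` coordinate matrices is made term by term:

* `quatVec_im_commutator_smul` — `[quatVec(0, c v), quatVec(0, y)] = quatVec(0, ((−2c)[v]_×) y)`;
* **`ad_iterate_quatVec_im`** — `ad_{quatVec(0, c v)}^k (quatVec(0, w)) = quatVec(0, ((−2c)[v]_×)^k w)`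
  for every `k`;
* `quatVecIm_add`, `quatVecIm_smul`, `quatVecIm_sum` — `w ↦ quatVec(0, w)` is `ℝ`-linear;
* **`luscherSeries_partialSum`** — for every `K`, the engine's truncated series applied to a
  coordinate vector: `Σ_{k<K} ((−1)^k/(k+1)!) • ad^k (quatVec(0, w)) = quatVec(0, P_K w)` with
  `P_K = Σ_{k<K} (1/(k+1)!) • (2c[v]_×)^k` — the `K`-term truncation of `φ(2c[v]_×)` of
  `SU2LuscherDeterminant.det_one_add_phi_mul_luscherD` (so with `w = D t`,
  `D = −c(j₀ − [v]_×)` = `luscherD_quatVec`, the booked `M_K` is `1 + P_K D` in these coordinates);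
* **`tendsto_det_luscher_partialSum`** — as `K → ∞`, `det(1 + P_K D) → det(1 + φ(2c[v]_×) D)`,
  the closed-form density (`B13HaarSigma.hasSum_phi`, continuity of `det`): the number the engine
  books converges, in the truncation order, to the density the typed member certifies;
* **`hasJacobian_su2Kick_luscherDet`** — THE CERTIFICATE IN THE ENGINE'S OWN TERMS: for
  `|c|‖J‖ ≤ 1` the `SU(2)` kick has `HasJacobian (haarProbability SU(2))` with density
  `Re det(1 + φ(2c[j⃗]_×) · (−c)(j₀ − [j⃗]_×))`, `j = U⁻¹ ⋆ J` — row 7's / GEN-7's closed-form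
  certificate rewritten through `SU2LuscherDeterminant` (no Lie calculus: both sides are closed
  forms).

NOT CLAIMED: the engine's quantitative remainder bound `(2κ)^K/(K+1)! < 1e−17` behind its choice
of `K`; the identification of the engine's generator basis with the quaternion basis (any basis
gives the same determinant); `SU(N ≥ 3)`; any number.
-/

noncomputable section

namespace Summit.Ventures.LatticeQCDFlow.Exactness

open Real WithLp Matrix Filter
open Literature.MathematicalPhysics.QuantumFieldTheory.Balaban1983to89.B13HaarSigma
  (phi phiCoeff hasSum_phi continuous_det)
open Literature.MathematicalPhysics.QuantumFieldTheory.Balaban1983to89.B10Eq18SigmaSU2 (crossMatrix)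
open scoped Matrix.Norms.Operator Topology Nat

/-! ## `ad` and its powers in quaternion coordinates -/

/-- `[quatVec(0, c v), quatVec(0, y)] = quatVec(0, ((−2c)[v]_×) y)`. -/
theorem quatVec_im_commutator_smul (c : ℝ) (v y : Fin 3 → ℝ) :
    quatVec (toLp 2 ![0, c * v 0, c * v 1, c * v 2]) * quatVec (toLp 2 ![0, y 0, y 1, y 2]) -
        quatVec (toLp 2 ![0, y 0, y 1, y 2]) * quatVec (toLp 2 ![0, c * v 0, c * v 1, c * v 2]) =
      quatVec (toLp 2 ![0, (((-2 * c) • crossMatrix v).mulVec y) 0,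
        (((-2 * c) • crossMatrix v).mulVec y) 1, (((-2 * c) • crossMatrix v).mulVec y) 2]) := by
  ext i j
  fin_cases i <;> fin_cases j <;> apply Complex.ext <;>
    simp [Matrix.mul_apply, Fin.sum_univ_two, Matrix.sub_apply, crossMatrix, Matrix.mulVec,
      dotProduct, Fin.sum_univ_three, Matrix.smul_apply]
  all_goals ring

/-- **Powers of `ad` in quaternion coordinates**: for `X = quatVec(0, c v)`,
`ad_X^k (quatVec(0, w)) = quatVec(0, ((−2c)[v]_×)^k w)`. -/
theorem ad_iterate_quatVec_im (c : ℝ) (v : Fin 3 → ℝ) (k : ℕ) (w : Fin 3 → ℝ) :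
    (fun Y : Matrix (Fin 2) (Fin 2) ℂ =>
        quatVec (toLp 2 ![0, c * v 0, c * v 1, c * v 2]) * Y -
          Y * quatVec (toLp 2 ![0, c * v 0, c * v 1, c * v 2]))^[k]
        (quatVec (toLp 2 ![0, w 0, w 1, w 2])) =
      quatVec (toLp 2 ![0, ((((-2 * c) • crossMatrix v) ^ k).mulVec w) 0,
        ((((-2 * c) • crossMatrix v) ^ k).mulVec w) 1, ((((-2 * c) • crossMatrix v) ^ k).mulVec w) 2]) := by
  induction k with
  | zero => simp
  | succ k ih =>
    rw [Function.iterate_succ_apply', ih, quatVec_im_commutator_smul, Matrix.mulVec_mulVec,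
      ← pow_succ']

/-! ## `w ↦ quatVec(0, w)` is linear -/

/-- Additivity. -/
theorem quatVecIm_add (w w' : Fin 3 → ℝ) :
    quatVec (toLp 2 ![0, (w + w') 0, (w + w') 1, (w + w') 2]) =
      quatVec (toLp 2 ![0, w 0, w 1, w 2]) + quatVec (toLp 2 ![0, w' 0, w' 1, w' 2]) := by
  ext i j
  fin_cases i <;> fin_cases j <;> apply Complex.ext <;> simp [Matrix.add_apply] <;> ring

/-- Homogeneity. -/
theorem quatVecIm_smul (a : ℝ) (w : Fin 3 → ℝ) :
    quatVec (toLp 2 ![0, (a • w) 0, (a • w) 1, (a • w) 2]) =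
      (a : ℂ) • quatVec (toLp 2 ![0, w 0, w 1, w 2]) := by
  ext i j
  fin_cases i <;> fin_cases j <;> apply Complex.ext <;> simp [Matrix.smul_apply]

/-- Finite sums. -/
theorem quatVecIm_sum {ι : Type*} (s : Finset ι) (f : ι → Fin 3 → ℝ) :
    quatVec (toLp 2 ![0, (∑ k ∈ s, f k) 0, (∑ k ∈ s, f k) 1, (∑ k ∈ s, f k) 2]) =
      ∑ k ∈ s, quatVec (toLp 2 ![0, f k 0, f k 1, f k 2]) := by
  classical
  induction s using Finset.induction_on with
  | empty =>
    simp only [Finset.sum_empty]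
    ext i j
    fin_cases i <;> fin_cases j <;> simp
  | insert a s ha ih =>
    rw [Finset.sum_insert ha, Finset.sum_insert ha, quatVecIm_add, ih]

/-! ## The truncated series -/

/-- The coefficient bookkeeping: `((−1)^k/(k+1)!) ((−2c)N)^k = (1/(k+1)!) (2cN)^k`. -/
theorem luscher_term_eq (c : ℝ) (v : Fin 3 → ℝ) (k : ℕ) :
    ((-1 : ℝ) ^ k / ((k + 1)! : ℕ)) • ((-2 * c) • crossMatrix v) ^ k =
      ((1 : ℝ) / ((k + 1)! : ℕ)) • (((2 * c) • crossMatrix v) ^ k) := by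
  rw [smul_pow, smul_pow, smul_smul, smul_smul]
  congr 1
  rw [show (-2 * c) = (-1) * (2 * c) by ring, mul_pow, ← mul_assoc, div_mul_eq_mul_div,
    ← pow_add, ← two_mul, pow_mul, neg_one_sq, one_pow]

/-- **The engine's `K`-term `Φ`-series applied to `DQ[T]`, in quaternion coordinates.**  For
`X = quatVec(0, c v)` and any coordinate vector `w` (in the application `w = D t`):
`Σ_{k<K} ((−1)^k/(k+1)!) • ad_X^k (quatVec(0, w)) = quatVec(0, P_K w)`,
`P_K = Σ_{k<K} (1/(k+1)!) • (2c[v]_×)^k`. -/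
theorem luscherSeries_partialSum (c : ℝ) (v : Fin 3 → ℝ) (K : ℕ) (w : Fin 3 → ℝ) :
    ∑ k ∈ Finset.range K, (((-1 : ℝ) ^ k / ((k + 1)! : ℕ) : ℝ) : ℂ) •
        (fun Y : Matrix (Fin 2) (Fin 2) ℂ =>
          quatVec (toLp 2 ![0, c * v 0, c * v 1, c * v 2]) * Y -
            Y * quatVec (toLp 2 ![0, c * v 0, c * v 1, c * v 2]))^[k]
          (quatVec (toLp 2 ![0, w 0, w 1, w 2])) =
      quatVec (toLp 2 ![0,
        ((∑ k ∈ Finset.range K, ((1 : ℝ) / ((k + 1)! : ℕ)) • ((2 * c) • crossMatrix v) ^ k).mulVec w) 0,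
        ((∑ k ∈ Finset.range K, ((1 : ℝ) / ((k + 1)! : ℕ)) • ((2 * c) • crossMatrix v) ^ k).mulVec w) 1,
        ((∑ k ∈ Finset.range K, ((1 : ℝ) / ((k + 1)! : ℕ)) • ((2 * c) • crossMatrix v) ^ k).mulVec w) 2]) := by
  rw [Matrix.sum_mulVec]
  rw [quatVecIm_sum]
  refine Finset.sum_congr rfl fun k _ => ?_
  rw [ad_iterate_quatVec_im, ← luscher_term_eq, Matrix.smul_mulVec, quatVecIm_smul]

/-! ## The limit `K → ∞` -/

set_option backward.isDefEq.respectTransparency false in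
/-- **The booked number converges, in the truncation order, to the certified density.**  With
`N = [v]_×` and `D = −c(j₀·1 − N)` cast to `ℂ`:
`det(1 + (Σ_{k<K} (1/(k+1)!) (2cN)^k) D) → det(1 + φ(2cN) D)` as `K → ∞` — the right-hand side
being the closed form of `SU2LuscherDeterminant.det_one_add_phi_mul_luscherD`. -/
theorem tendsto_det_luscher_partialSum (c j₀ : ℝ) (v : Fin 3 → ℝ) :
    Tendsto (fun K : ℕ => ((1 : Matrix (Fin 3) (Fin 3) ℂ) +
        (∑ k ∈ Finset.range K, phiCoeff k • (((2 * c : ℝ) : ℂ) • crossMatrix (fun i => (v i : ℂ))) ^ k) *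
          (-(c : ℂ) • ((j₀ : ℂ) • (1 : Matrix (Fin 3) (Fin 3) ℂ) - crossMatrix (fun i => (v i : ℂ))))).det)
      atTop
      (𝓝 (((1 : Matrix (Fin 3) (Fin 3) ℂ) +
        phi (((2 * c : ℝ) : ℂ) • crossMatrix (fun i => (v i : ℂ))) *
          (-(c : ℂ) • ((j₀ : ℂ) • (1 : Matrix (Fin 3) (Fin 3) ℂ) - crossMatrix (fun i => (v i : ℂ))))).det)) := by
  have hsum := (hasSum_phi (((2 * c : ℝ) : ℂ) • crossMatrix (fun i => (v i : ℂ)))).tendsto_sum_nat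
  have hcont : Continuous fun P : Matrix (Fin 3) (Fin 3) ℂ => ((1 : Matrix (Fin 3) (Fin 3) ℂ) +
      P * (-(c : ℂ) • ((j₀ : ℂ) • (1 : Matrix (Fin 3) (Fin 3) ℂ) - crossMatrix (fun i => (v i : ℂ))))).det :=
    continuous_det.comp (continuous_const.add (continuous_id.mul continuous_const))
  exact (hcont.tendsto _).comp hsum


/-! ## The certificate with the engine's density -/

section Certificate

open InnerProductGeometry MeasureTheory
open Literature.MathematicalPhysics.QuantumFieldTheory (haarProbability)

set_option backward.isDefEq.respectTransparency false in
/-- **The `SU(2)` kick is certified for Haar measure with LÜSCHER'S determinant as its density.**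
For `|c|‖J‖ ≤ 1`, with `j = U⁻¹ ⋆ J`, `j₀ = j 0`, `j⃗ = (j 1, j 2, j 3)`, `N = [j⃗]_×`,
`D = −c(j₀·1 − N)`: `HasJacobian (haarProbability SU(2)) (U ↦ gaussUnit (geodesicKick c J (vecQuat U)))
(U ↦ Re det(1 + φ(2cN) D))` — `SU2KickPositiveJacobian.hasJacobian_su2Kick_fix` with its repaired
closed-form density REWRITTEN as the value of the engine's log-det formula
(`det_one_add_phi_mul_luscherD` + `luscherDet_closedForm_eq_booked`).  No Lie calculus is used:
both sides are closed forms. -/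
theorem hasJacobian_su2Kick_luscherDet {c : ℝ} {J : R4} (hc : |c| * ‖J‖ ≤ 1) :
    HasJacobian (haarProbability (Matrix.specialUnitaryGroup (Fin 2) ℂ))
      (fun U : Matrix.specialUnitaryGroup (Fin 2) ℂ =>
        gaussUnit (geodesicKick c J (vecQuat (U : Matrix (Fin 2) (Fin 2) ℂ))))
      fun U => ENNReal.ofReal (Complex.re (((1 : Matrix (Fin 3) (Fin 3) ℂ) +
        phi (((2 * c : ℝ) : ℂ) • crossMatrix (fun i =>
          ((![(lmulIso U⁻¹ J) 1, (lmulIso U⁻¹ J) 2, (lmulIso U⁻¹ J) 3] : Fin 3 → ℝ) i : ℂ))) *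
          (-(c : ℂ) • ((((lmulIso U⁻¹ J) 0 : ℝ) : ℂ) • (1 : Matrix (Fin 3) (Fin 3) ℂ) -
            crossMatrix (fun i => ((![(lmulIso U⁻¹ J) 1, (lmulIso U⁻¹ J) 2, (lmulIso U⁻¹ J) 3] : Fin 3 → ℝ) i : ℂ))))).det)) := by
  have key : ∀ U : Matrix.specialUnitaryGroup (Fin 2) ℂ,
      Complex.re (((1 : Matrix (Fin 3) (Fin 3) ℂ) +
        phi (((2 * c : ℝ) : ℂ) • crossMatrix (fun i =>
          ((![(lmulIso U⁻¹ J) 1, (lmulIso U⁻¹ J) 2, (lmulIso U⁻¹ J) 3] : Fin 3 → ℝ) i : ℂ))) *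
          (-(c : ℂ) • ((((lmulIso U⁻¹ J) 0 : ℝ) : ℂ) • (1 : Matrix (Fin 3) (Fin 3) ℂ) -
            crossMatrix (fun i => ((![(lmulIso U⁻¹ J) 1, (lmulIso U⁻¹ J) 2, (lmulIso U⁻¹ J) 3] : Fin 3 → ℝ) i : ℂ))))).det) =
      (if Real.sin (angle J (vecQuat (U : Matrix (Fin 2) (Fin 2) ℂ))) = 0 then
          (1 - c * ‖J‖ * Real.cos (angle J (vecQuat (U : Matrix (Fin 2) (Fin 2) ℂ)))) ^ 3
        else kickJac (c * ‖J‖) 2 (angle J (vecQuat (U : Matrix (Fin 2) (Fin 2) ℂ)))) := by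
    intro U
    rw [det_one_add_phi_mul_luscherD, ← luscherDet_closedForm_eq_booked c U J]
    split_ifs <;> simp only [Complex.ofReal_re]
  simp_rw [key]
  exact hasJacobian_su2Kick_fix hc

end Certificate

end Summit.Ventures.LatticeQCDFlow.Exactness
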